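import Summits.QuantumFields.YangMills.Theorems.AllWindowsColdBoxBoxHighLineHodgePoincareFaces

/-!
# LINE-19 stub S1 `HodgePoincareColdBox` (crux `AllWindowsColdBox.BoxHighWindowsSU22`, stmt-QuantumFields-24004 / low item 24335),
# part 4: boundary-layer reduction and the ℓ² Hodge–Poincaré inequality for edge functions on the cube

* `plaq_energy_le_norm` — the plaquette energy of any box-supported edge function is `≤ 64·‖·‖²` (crude);
* `boundary_reduction` — `¼‖u − uc‖² + (1/258)·F(uc) ≤ F(u)` for the plaquette energy `F` and the core part `uc`
  (per-plaquette convexity `(c+τ)² ≥ c²/129 − τ²/128`, the exterior-plaquette mass of part 3, and the crude bound for `τ = u − uc`);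
* `norm_sq_le_hodge` — **`Σ_e u_e² ≤ 86·N²·(Σ_plaquettes circ² + Σ_{interior sites} div²)`** for every real edge function
  supported on the edges of `[0,N]⁴`, `N ≥ 1`: the interior divergence only sees core edges, the core part obeys the
  energy identity of part 2 and the one-dimensional Dirichlet Poincaré inequality of part 1 in each of its three transverse
  directions, and the face-tangential part is paid by `boundary_reduction`.
Mathlib only (via parts 1–3).  HONEST LABEL: helper toward ONE registered stub of a critic-PASSed line; no crux, rung or summit
is proved; the Yang–Mills mass gap is NOT proved by this file.
-/

set_option autoImplicit false

open Finset

namespace Summit.QuantumFields.YangMills.Theorems.AllWindowsColdBoxBoxHighLine.HodgePoincare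

section Boundary

variable {N : ℕ} {u : (Fin 4 → ℤ) × Fin 4 → ℝ}
  (hsupp : ∀ x i, u (x, i) ≠ 0 → (∀ k, 0 ≤ x k ∧ x k ≤ N) ∧ x i + 1 ≤ N)

/-- The plaquette energy of ANY edge function supported in `[0,N]⁴` is at most `64` times its squared norm (crude: each
squared circulation is at most four times the sum of its four squared edge values). -/
theorem plaq_energy_le_norm (w : (Fin 4 → ℤ) × Fin 4 → ℝ) (hw : ∀ x i, w (x, i) ≠ 0 → ∀ k, 0 ≤ x k ∧ x k ≤ N) :
    ∑ z ∈ Fintype.piFinset (fun _ : Fin 4 => Finset.Icc (-2 : ℤ) (N + 2)), ∑ i : Fin 4, ∑ j : Fin 4,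
        (if i < j then (w (z, i) + w (z + Pi.single i 1, j) - w (z + Pi.single j 1, i) - w (z, j)) ^ 2 else 0) ≤
      64 * ∑ x ∈ Fintype.piFinset (fun _ : Fin 4 => Finset.Icc (-2 : ℤ) (N + 2)), ∑ i : Fin 4, w (x, i) ^ 2 := by
  have hsq0 : ∀ x i, 0 ≤ w (x, i) ^ 2 := fun x i => sq_nonneg _
  have hsqsupp : ∀ i, ∀ x, w (x, i) ^ 2 ≠ 0 → ∀ k, (-2 : ℤ) ≤ x k ∧ x k ≤ N + 2 := by
    intro i x hx k
    have : w (x, i) ≠ 0 := fun h => hx (by rw [h]; ring)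
    have := hw x i this k
    constructor <;> omega
  have hpt : ∀ (z : Fin 4 → ℤ) (i j : Fin 4),
      (if i < j then (w (z, i) + w (z + Pi.single i 1, j) - w (z + Pi.single j 1, i) - w (z, j)) ^ 2 else 0) ≤
        4 * (w (z, i) ^ 2 + w (z + Pi.single i 1, j) ^ 2 + w (z + Pi.single j 1, i) ^ 2 + w (z, j) ^ 2) := by
    intro z i j
    split_ifs
    · nlinarith [sq_nonneg (w (z, i) - w (z + Pi.single i 1, j)), sq_nonneg (w (z, i) + w (z + Pi.single j 1, i)),
        sq_nonneg (w (z, i) + w (z, j)), sq_nonneg (w (z + Pi.single i 1, j) + w (z + Pi.single j 1, i)),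
        sq_nonneg (w (z + Pi.single i 1, j) + w (z, j)), sq_nonneg (w (z + Pi.single j 1, i) - w (z, j))]
    · positivity
  have T0 : ∀ i : Fin 4, ∑ j : Fin 4, ∑ z ∈ Fintype.piFinset (fun _ : Fin 4 => Finset.Icc (-2 : ℤ) (N + 2)), w (z, i) ^ 2 =
      4 * ∑ z ∈ Fintype.piFinset (fun _ : Fin 4 => Finset.Icc (-2 : ℤ) (N + 2)), w (z, i) ^ 2 := by
    intro i; simp
  have Ti : ∀ i j : Fin 4, ∑ z ∈ Fintype.piFinset (fun _ : Fin 4 => Finset.Icc (-2 : ℤ) (N + 2)), w (z + Pi.single i 1, j) ^ 2 ≤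
      ∑ z ∈ Fintype.piFinset (fun _ : Fin 4 => Finset.Icc (-2 : ℤ) (N + 2)), w (z, j) ^ 2 := by
    intro i j
    exact sum_shift_le (Pi.single i 1) (fun x => w (x, j) ^ 2) (fun x => hsq0 x j) (hsqsupp j)
  calc ∑ z ∈ Fintype.piFinset (fun _ : Fin 4 => Finset.Icc (-2 : ℤ) (N + 2)), ∑ i : Fin 4, ∑ j : Fin 4,
        (if i < j then (w (z, i) + w (z + Pi.single i 1, j) - w (z + Pi.single j 1, i) - w (z, j)) ^ 2 else 0)
      ≤ ∑ z ∈ Fintype.piFinset (fun _ : Fin 4 => Finset.Icc (-2 : ℤ) (N + 2)), ∑ i : Fin 4, ∑ j : Fin 4,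
        4 * (w (z, i) ^ 2 + w (z + Pi.single i 1, j) ^ 2 + w (z + Pi.single j 1, i) ^ 2 + w (z, j) ^ 2) := by
        refine Finset.sum_le_sum fun z _ => Finset.sum_le_sum fun i _ => Finset.sum_le_sum fun j _ => ?_
        exact hpt z i j
    _ = 4 * (∑ i : Fin 4, ∑ j : Fin 4, ∑ z ∈ Fintype.piFinset (fun _ : Fin 4 => Finset.Icc (-2 : ℤ) (N + 2)), w (z, i) ^ 2 +
          ∑ i : Fin 4, ∑ j : Fin 4, ∑ z ∈ Fintype.piFinset (fun _ : Fin 4 => Finset.Icc (-2 : ℤ) (N + 2)), w (z + Pi.single i 1, j) ^ 2 +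
          ∑ i : Fin 4, ∑ j : Fin 4, ∑ z ∈ Fintype.piFinset (fun _ : Fin 4 => Finset.Icc (-2 : ℤ) (N + 2)), w (z + Pi.single j 1, i) ^ 2 +
          ∑ i : Fin 4, ∑ j : Fin 4, ∑ z ∈ Fintype.piFinset (fun _ : Fin 4 => Finset.Icc (-2 : ℤ) (N + 2)), w (z, j) ^ 2) := by
        rw [Finset.sum_comm]
        simp only [Finset.mul_sum, Finset.sum_add_distrib, mul_add]
        congr 1
        · congr 1
          · congr 1
            all_goals (refine Finset.sum_congr rfl fun i _ => ?_; rw [Finset.sum_comm])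
          · refine Finset.sum_congr rfl fun i _ => ?_; rw [Finset.sum_comm]
        · refine Finset.sum_congr rfl fun i _ => ?_; rw [Finset.sum_comm]
    _ ≤ 4 * (4 * ∑ x ∈ Fintype.piFinset (fun _ : Fin 4 => Finset.Icc (-2 : ℤ) (N + 2)), ∑ i : Fin 4, w (x, i) ^ 2 +
          4 * ∑ x ∈ Fintype.piFinset (fun _ : Fin 4 => Finset.Icc (-2 : ℤ) (N + 2)), ∑ i : Fin 4, w (x, i) ^ 2 +
          4 * ∑ x ∈ Fintype.piFinset (fun _ : Fin 4 => Finset.Icc (-2 : ℤ) (N + 2)), ∑ i : Fin 4, w (x, i) ^ 2 +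
          4 * ∑ x ∈ Fintype.piFinset (fun _ : Fin 4 => Finset.Icc (-2 : ℤ) (N + 2)), ∑ i : Fin 4, w (x, i) ^ 2) := by
        have e1 : ∑ i : Fin 4, ∑ j : Fin 4, ∑ z ∈ Fintype.piFinset (fun _ : Fin 4 => Finset.Icc (-2 : ℤ) (N + 2)), w (z, i) ^ 2 =
            4 * ∑ x ∈ Fintype.piFinset (fun _ : Fin 4 => Finset.Icc (-2 : ℤ) (N + 2)), ∑ i : Fin 4, w (x, i) ^ 2 := by
          rw [Finset.sum_comm (s := Fintype.piFinset (fun _ : Fin 4 => Finset.Icc (-2 : ℤ) (N + 2))), Finset.mul_sum]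
          exact Finset.sum_congr rfl fun i _ => T0 i
        have e4 : ∑ i : Fin 4, ∑ j : Fin 4, ∑ z ∈ Fintype.piFinset (fun _ : Fin 4 => Finset.Icc (-2 : ℤ) (N + 2)), w (z, j) ^ 2 =
            4 * ∑ x ∈ Fintype.piFinset (fun _ : Fin 4 => Finset.Icc (-2 : ℤ) (N + 2)), ∑ i : Fin 4, w (x, i) ^ 2 := by
          rw [Finset.sum_comm (s := (Finset.univ : Finset (Fin 4))) (t := (Finset.univ : Finset (Fin 4)))]
          exact e1
        have e2 : ∑ i : Fin 4, ∑ j : Fin 4, ∑ z ∈ Fintype.piFinset (fun _ : Fin 4 => Finset.Icc (-2 : ℤ) (N + 2)),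
            w (z + Pi.single i 1, j) ^ 2 ≤
            4 * ∑ x ∈ Fintype.piFinset (fun _ : Fin 4 => Finset.Icc (-2 : ℤ) (N + 2)), ∑ i : Fin 4, w (x, i) ^ 2 := by
          rw [← e4]
          exact Finset.sum_le_sum fun i _ => Finset.sum_le_sum fun j _ => Ti i j
        have e3 : ∑ i : Fin 4, ∑ j : Fin 4, ∑ z ∈ Fintype.piFinset (fun _ : Fin 4 => Finset.Icc (-2 : ℤ) (N + 2)),
            w (z + Pi.single j 1, i) ^ 2 ≤
            4 * ∑ x ∈ Fintype.piFinset (fun _ : Fin 4 => Finset.Icc (-2 : ℤ) (N + 2)), ∑ i : Fin 4, w (x, i) ^ 2 := by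
          rw [← e1]
          exact Finset.sum_le_sum fun i _ => Finset.sum_le_sum fun j _ => Ti j i
        linarith
    _ = 64 * ∑ x ∈ Fintype.piFinset (fun _ : Fin 4 => Finset.Icc (-2 : ℤ) (N + 2)), ∑ i : Fin 4, w (x, i) ^ 2 := by ring

/-- Per-plaquette convexity: `(c + τ)² ≥ c²/129 − τ²/128`. -/
theorem sq_add_ge (c τ : ℝ) : c ^ 2 / 129 - τ ^ 2 / 128 ≤ (c + τ) ^ 2 := by
  nlinarith [sq_nonneg (128 * c + 129 * τ)]

include hsupp in
/-- **Boundary-layer reduction.**  With `uc` the core part of `u` (transversally interior edges) and `t = u − uc` the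
face-tangential part: `¼‖t‖² + (1/258)·F(uc) ≤ F(u)`, where `F` is the plaquette energy over the cube `[-2,N+2]⁴`. -/
theorem boundary_reduction (uc : (Fin 4 → ℤ) × Fin 4 → ℝ)
    (huc : ∀ x i, uc (x, i) = if (∀ k, k ≠ i → 1 ≤ x k ∧ x k + 1 ≤ N) then u (x, i) else 0) :
    (1 / 4) * ∑ x ∈ Fintype.piFinset (fun _ : Fin 4 => Finset.Icc (-2 : ℤ) (N + 2)), ∑ i : Fin 4, (u (x, i) - uc (x, i)) ^ 2 +
      (1 / 258) * ∑ z ∈ Fintype.piFinset (fun _ : Fin 4 => Finset.Icc (-2 : ℤ) (N + 2)), ∑ i : Fin 4, ∑ j : Fin 4,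
        (if i < j then (uc (z, i) + uc (z + Pi.single i 1, j) - uc (z + Pi.single j 1, i) - uc (z, j)) ^ 2 else 0) ≤
    ∑ z ∈ Fintype.piFinset (fun _ : Fin 4 => Finset.Icc (-2 : ℤ) (N + 2)), ∑ i : Fin 4, ∑ j : Fin 4,
        (if i < j then (u (z, i) + u (z + Pi.single i 1, j) - u (z + Pi.single j 1, i) - u (z, j)) ^ 2 else 0) := by
  -- the tangential part is supported in the box
  have htsupp : ∀ x i, u (x, i) - uc (x, i) ≠ 0 → ∀ k, 0 ≤ x k ∧ x k ≤ N := by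
    intro x i h
    have : u (x, i) ≠ 0 := by
      intro h0; apply h; rw [huc, h0]; simp
    exact (hsupp x i this).1
  have hmass := tangential_mass_le hsupp uc huc
  have hFt := plaq_energy_le_norm (N := N) (fun e => u e - uc e) (fun x i h => htsupp x i h)
  -- per plaquette: circ(u)² ≥ circ(uc)²/129 − circ(t)²/128
  have hpt : ∀ (z : Fin 4 → ℤ) (i j : Fin 4),
      (if i < j then (uc (z, i) + uc (z + Pi.single i 1, j) - uc (z + Pi.single j 1, i) - uc (z, j)) ^ 2 else 0) / 129 -
        (if i < j then ((u (z, i) - uc (z, i)) + (u (z + Pi.single i 1, j) - uc (z + Pi.single i 1, j)) -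
          (u (z + Pi.single j 1, i) - uc (z + Pi.single j 1, i)) - (u (z, j) - uc (z, j))) ^ 2 else 0) / 128 ≤
      (if i < j then (u (z, i) + u (z + Pi.single i 1, j) - u (z + Pi.single j 1, i) - u (z, j)) ^ 2 else 0) := by
    intro z i j
    split_ifs
    · have := sq_add_ge (uc (z, i) + uc (z + Pi.single i 1, j) - uc (z + Pi.single j 1, i) - uc (z, j))
        ((u (z, i) - uc (z, i)) + (u (z + Pi.single i 1, j) - uc (z + Pi.single i 1, j)) -
          (u (z + Pi.single j 1, i) - uc (z + Pi.single j 1, i)) - (u (z, j) - uc (z, j)))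
      refine le_trans (le_of_eq (by ring)) (this.trans (le_of_eq (by ring)))
    · simp
  have hconv : (∑ z ∈ Fintype.piFinset (fun _ : Fin 4 => Finset.Icc (-2 : ℤ) (N + 2)), ∑ i : Fin 4, ∑ j : Fin 4,
        (if i < j then (uc (z, i) + uc (z + Pi.single i 1, j) - uc (z + Pi.single j 1, i) - uc (z, j)) ^ 2 else 0)) / 129 -
      (∑ z ∈ Fintype.piFinset (fun _ : Fin 4 => Finset.Icc (-2 : ℤ) (N + 2)), ∑ i : Fin 4, ∑ j : Fin 4,
        (if i < j then ((u (z, i) - uc (z, i)) + (u (z + Pi.single i 1, j) - uc (z + Pi.single i 1, j)) -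
          (u (z + Pi.single j 1, i) - uc (z + Pi.single j 1, i)) - (u (z, j) - uc (z, j))) ^ 2 else 0)) / 128 ≤
      ∑ z ∈ Fintype.piFinset (fun _ : Fin 4 => Finset.Icc (-2 : ℤ) (N + 2)), ∑ i : Fin 4, ∑ j : Fin 4,
        (if i < j then (u (z, i) + u (z + Pi.single i 1, j) - u (z + Pi.single j 1, i) - u (z, j)) ^ 2 else 0) := by
    rw [Finset.sum_div, Finset.sum_div, ← Finset.sum_sub_distrib]
    refine Finset.sum_le_sum fun z _ => ?_
    rw [Finset.sum_div, Finset.sum_div, ← Finset.sum_sub_distrib]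
    refine Finset.sum_le_sum fun i _ => ?_
    rw [Finset.sum_div, Finset.sum_div, ← Finset.sum_sub_distrib]
    refine Finset.sum_le_sum fun j _ => ?_
    exact hpt z i j
  have hFt' : ∑ z ∈ Fintype.piFinset (fun _ : Fin 4 => Finset.Icc (-2 : ℤ) (N + 2)), ∑ i : Fin 4, ∑ j : Fin 4,
        (if i < j then ((u (z, i) - uc (z, i)) + (u (z + Pi.single i 1, j) - uc (z + Pi.single i 1, j)) -
          (u (z + Pi.single j 1, i) - uc (z + Pi.single j 1, i)) - (u (z, j) - uc (z, j))) ^ 2 else 0) ≤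
      64 * ∑ x ∈ Fintype.piFinset (fun _ : Fin 4 => Finset.Icc (-2 : ℤ) (N + 2)), ∑ i : Fin 4, (u (x, i) - uc (x, i)) ^ 2 := by
    exact hFt
  linarith

end Boundary

/-! ## Part 4: assembly for edge functions on the cube -/

/-- **The ℓ² Hodge–Poincaré inequality for the cold box, function form.**  For every real edge function `u` supported on
the edges of the cube `[0,N]⁴` (`N ≥ 1`):
`Σ_e u_e² ≤ 86·N²·(Σ_plaquettes circ² + Σ_{interior sites} div²)`,
the plaquette sum running over all plaquettes based in `[-2,N+2]⁴` and the divergence over the interior cube `[1,N−1]⁴`. -/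
theorem norm_sq_le_hodge (N : ℕ) (hN : 1 ≤ N) (u : (Fin 4 → ℤ) × Fin 4 → ℝ)
    (hsupp : ∀ x i, u (x, i) ≠ 0 → (∀ k, 0 ≤ x k ∧ x k ≤ N) ∧ x i + 1 ≤ N) :
    ∑ x ∈ Fintype.piFinset (fun _ : Fin 4 => Finset.Icc (-2 : ℤ) (N + 2)), ∑ i : Fin 4, u (x, i) ^ 2 ≤
      86 * (N : ℝ) ^ 2 *
        (∑ z ∈ Fintype.piFinset (fun _ : Fin 4 => Finset.Icc (-2 : ℤ) (N + 2)), ∑ i : Fin 4, ∑ j : Fin 4,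
            (if i < j then (u (z, i) + u (z + Pi.single i 1, j) - u (z + Pi.single j 1, i) - u (z, j)) ^ 2 else 0) +
          ∑ x ∈ Fintype.piFinset (fun _ : Fin 4 => Finset.Icc (1 : ℤ) (N - 1)),
            (∑ i : Fin 4, (u (x - Pi.single i 1, i) - u (x, i))) ^ 2) := by
  classical
  -- the core part
  obtain ⟨uc, huc⟩ : ∃ uc : (Fin 4 → ℤ) × Fin 4 → ℝ,
      ∀ x i, uc (x, i) = if (∀ k, k ≠ i → 1 ≤ x k ∧ x k + 1 ≤ N) then u (x, i) else 0 :=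
    ⟨fun e => if (∀ k, k ≠ e.2 → 1 ≤ e.1 k ∧ e.1 k + 1 ≤ N) then u e else 0, fun _ _ => rfl⟩
  have hcsupp : ∀ x i, uc (x, i) ≠ 0 → ∀ k, 0 ≤ x k ∧ x k ≤ N := by
    intro x i h
    rw [huc] at h
    split_ifs at h with hc
    · exact (hsupp x i h).1
    · exact absurd rfl h
  have hccore : ∀ x i, uc (x, i) ≠ 0 → ∀ k, k ≠ i → 1 ≤ x k ∧ x k + 1 ≤ N := by
    intro x i h
    rw [huc] at h
    split_ifs at h with hc
    · exact hc
    · exact absurd rfl h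
  -- norms split: u² = uc² + t²
  have hnorm : ∀ x i, u (x, i) ^ 2 = uc (x, i) ^ 2 + (u (x, i) - uc (x, i)) ^ 2 := by
    intro x i; rw [huc]; split_ifs <;> ring
  -- divergence of u = divergence of uc at interior sites
  have hdiv : ∑ x ∈ Fintype.piFinset (fun _ : Fin 4 => Finset.Icc (1 : ℤ) (N - 1)),
        (∑ i : Fin 4, (u (x - Pi.single i 1, i) - u (x, i))) ^ 2 =
      ∑ x ∈ Fintype.piFinset (fun _ : Fin 4 => Finset.Icc (1 : ℤ) (N - 1)),
        (∑ i : Fin 4, (uc (x - Pi.single i 1, i) - uc (x, i))) ^ 2 := by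
    refine Finset.sum_congr rfl fun x hx => ?_
    rw [mem_box] at hx
    congr 1
    refine Finset.sum_congr rfl fun i _ => ?_
    have h1 : uc (x, i) = u (x, i) := by
      rw [huc, if_pos]; intro k hk; have := hx k; constructor <;> omega
    have h2 : uc (x - Pi.single i 1, i) = u (x - Pi.single i 1, i) := by
      rw [huc, if_pos]; intro k hk
      have := hx k
      rw [Pi.sub_apply, Pi.single_eq_of_ne hk]
      constructor <;> omega
    rw [h1, h2]
  -- ingredients
  have hB := boundary_reduction hsupp uc huc
  have hC := core_energy N uc hcsupp hccore
  have hP : ∀ i j : Fin 4, i ≠ j →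
      ∑ x ∈ Fintype.piFinset (fun _ : Fin 4 => Finset.Icc (-2 : ℤ) (N + 2)), uc (x, j) ^ 2 ≤
        (N : ℝ) ^ 2 * ∑ x ∈ Fintype.piFinset (fun _ : Fin 4 => Finset.Icc (-2 : ℤ) (N + 2)),
          (uc (x + Pi.single i 1, j) - uc (x, j)) ^ 2 := by
    intro i j hij
    refine poincare_line (a := -2) (b := (N : ℤ) + 2) (by norm_num) N i (fun x => uc (x, j)) fun x hx => ?_
    have hb := hcsupp x j hx
    have hc := hccore x j hx i hij
    exact ⟨fun k => by have := hb k; constructor <;> omega, hc.1, hc.2⟩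
  -- Σ_{i≠j} ‖uc_j‖² = 3 ‖uc‖²
  have h3 : ∑ i : Fin 4, ∑ j : Fin 4, (if i ≠ j then
        ∑ x ∈ Fintype.piFinset (fun _ : Fin 4 => Finset.Icc (-2 : ℤ) (N + 2)), uc (x, j) ^ 2 else 0) =
      3 * ∑ x ∈ Fintype.piFinset (fun _ : Fin 4 => Finset.Icc (-2 : ℤ) (N + 2)), ∑ i : Fin 4, uc (x, i) ^ 2 := by
    have hcard : ∀ j : Fin 4, (Finset.univ.filter (fun i : Fin 4 => i ≠ j)).card = 3 := by
      intro j
      rw [Finset.filter_ne' Finset.univ j, Finset.card_erase_of_mem (Finset.mem_univ j)]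
      simp
    have inner : ∀ j : Fin 4, ∑ i : Fin 4, (if i ≠ j then
        ∑ x ∈ Fintype.piFinset (fun _ : Fin 4 => Finset.Icc (-2 : ℤ) (N + 2)), uc (x, j) ^ 2 else 0) =
        3 * ∑ x ∈ Fintype.piFinset (fun _ : Fin 4 => Finset.Icc (-2 : ℤ) (N + 2)), uc (x, j) ^ 2 := by
      intro j
      rw [Finset.sum_ite, Finset.sum_const_zero, add_zero, Finset.sum_const, nsmul_eq_mul, hcard j]
      norm_num
    rw [Finset.sum_comm]
    rw [Finset.sum_congr rfl fun j _ => inner j, ← Finset.mul_sum, Finset.sum_comm]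
  have hPsum : ∑ i : Fin 4, ∑ j : Fin 4, (if i ≠ j then
        ∑ x ∈ Fintype.piFinset (fun _ : Fin 4 => Finset.Icc (-2 : ℤ) (N + 2)), uc (x, j) ^ 2 else 0) ≤
      (N : ℝ) ^ 2 * ∑ i : Fin 4, ∑ j : Fin 4, (if i ≠ j then
        ∑ x ∈ Fintype.piFinset (fun _ : Fin 4 => Finset.Icc (-2 : ℤ) (N + 2)), (uc (x + Pi.single i 1, j) - uc (x, j)) ^ 2 else 0) := by
    rw [Finset.mul_sum]
    refine Finset.sum_le_sum fun i _ => ?_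
    rw [Finset.mul_sum]
    refine Finset.sum_le_sum fun j _ => ?_
    by_cases h : i ≠ j
    · rw [if_pos h, if_pos h]; exact hP i j h
    · rw [if_neg h, if_neg h, mul_zero]
  -- norms
  have hsplit : ∑ x ∈ Fintype.piFinset (fun _ : Fin 4 => Finset.Icc (-2 : ℤ) (N + 2)), ∑ i : Fin 4, u (x, i) ^ 2 =
      ∑ x ∈ Fintype.piFinset (fun _ : Fin 4 => Finset.Icc (-2 : ℤ) (N + 2)), ∑ i : Fin 4, uc (x, i) ^ 2 +
      ∑ x ∈ Fintype.piFinset (fun _ : Fin 4 => Finset.Icc (-2 : ℤ) (N + 2)), ∑ i : Fin 4, (u (x, i) - uc (x, i)) ^ 2 := by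
    rw [← Finset.sum_add_distrib]
    refine Finset.sum_congr rfl fun x _ => ?_
    rw [← Finset.sum_add_distrib]
    exact Finset.sum_congr rfl fun i _ => hnorm x i
  have hN1 : (1 : ℝ) ≤ (N : ℝ) ^ 2 := by
    have : (1 : ℝ) ≤ N := by exact_mod_cast hN
    nlinarith
  have hdivpos : 0 ≤ ∑ x ∈ Fintype.piFinset (fun _ : Fin 4 => Finset.Icc (1 : ℤ) (N - 1)),
        (∑ i : Fin 4, (uc (x - Pi.single i 1, i) - uc (x, i))) ^ 2 := Finset.sum_nonneg fun x _ => sq_nonneg _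
  have htpos : 0 ≤ ∑ x ∈ Fintype.piFinset (fun _ : Fin 4 => Finset.Icc (-2 : ℤ) (N + 2)), ∑ i : Fin 4, (u (x, i) - uc (x, i)) ^ 2 :=
    Finset.sum_nonneg fun x _ => Finset.sum_nonneg fun i _ => sq_nonneg _
  have hcpos : 0 ≤ ∑ x ∈ Fintype.piFinset (fun _ : Fin 4 => Finset.Icc (-2 : ℤ) (N + 2)), ∑ i : Fin 4, uc (x, i) ^ 2 :=
    Finset.sum_nonneg fun x _ => Finset.sum_nonneg fun i _ => sq_nonneg _
  rw [hdiv, hsplit]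
  rw [h3] at hPsum
  nlinarith [mul_nonneg (sub_nonneg.2 hN1) htpos, mul_nonneg (sub_nonneg.2 hN1) hcpos]

end Summit.QuantumFields.YangMills.Theorems.AllWindowsColdBoxBoxHighLine.HodgePoincare
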